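import Literature.AlgebraicGeometry.HodgeTheory.WeilClassesSquareDivisorPolynomialSquares
import Literature.AlgebraicGeometry.HodgeTheory.GysinFormalismHodgeOfGysin
import HarnessLib

/-!
# Sixfold and eightfold squares: a RATIONAL basis `{X, Y}` of the Weil plane as explicit cubic / quartic divisor polynomials

Family `hodge`, layer `Literature/AlgebraicGeometry/HodgeTheory`. Degree-`3` specialisation of `WeilClassesSquareDivisorPolynomial(Squares)`:
there the Weil lines of an intertwined square `(A, Φ; q₁, q₂)` (`Φ ≫ q₂ = q₁`, `Φ ≫ q₁ = -d·q₂`) are `E_± = ℂ · (R ± i√d·S)^{⌣g}` with the two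
degree-`2` classes `R = q₁^*θ - d·q₂^*θ`, `S = (q₁ + q₂)^*θ - q₁^*θ - q₂^*θ`. For SIXFOLDS (`g = 3`) and EIGHTFOLDS (`g = 4`, the anchors of
the ladder's door A(4,·)) we expand the power — with the products nested exactly as the tree's `cupPowTwo` nests them and WITHOUT using graded
commutativity —

  `(R + μS)^{⌣3} = X + μ·Y`,  `X = RRR - d·(RSS + SRS + SSR)`,  `Y = (RRS + RSR + SRR) - d·SSS`  (`μ² = -d`)

(`cupPowTwo_add_smul_three`, `cupPowTwo_weilGenerator_three`; in the commutative even subring `X = R³ - 3d·RS²`, `Y = 3R²S - d·S³`), and for `g = 4`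
`(R + μS)^{⌣4} = X₄ + μ·Y₄`, `X₄ = RRRR - d·Σ_{|S|=2} + d²·SSSS`, `Y₄ = Σ_{|S|=1} - d·Σ_{|S|=3}` (sums over the positions of the `S`-factors;
`cupPowTwo_add_smul_four`, `cupPowTwo_weilGenerator_four`; commutatively `X₄ = R⁴ - 6dR²S² + d²S⁴`, `Y₄ = 4R³S - 4dRS³`), so that

* `weilClassesOf_eq_span_weilX_weilY` (`g = 3`), `weilClassesOf_eq_span_weilX₄_weilY₄` (`g = 4`): **`W_K ⊗ ℂ = span_ℂ {X, Y}`** (from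
  `span {X + μY, X - μY}`, `μ = i√d ≠ 0`), and
* `isRationalClass_weilX`, `isRationalClass_weilY` (and `…X₄`, `…Y₄`): **`X` and `Y` are RATIONAL classes whenever `θ` is** (pull-backs, cup products and
  `ℤ`-combinations of rational classes are rational) — so for a rational `θ` (a polarization of `T`) the rational Weil classes of the sixfold
  are carried by the two explicit cubic divisor polynomials `X`, `Y` in the three divisor classes `q₁^*θ, q₂^*θ, (q₁+q₂)^*θ`;
* instances `weilClassesOf_splitSquare_three_eq_span` (`(T × T, Φ_d)`, `T` an abelian THREEFOLD, `(q₁,q₂) = (p₁,p₂)`: `R = θ₁ - dθ₂`, `S = ω`)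
  and `weilClassesOf_twistedSquare_three_eq_span` (`(T × T, φ × (-φ))`, `(q₁,q₂) = (p₁ ≫ φ - p₂ ≫ φ, p₁ + p₂)`), and the eightfold versions
  `weilClassesOf_splitSquare_four_eq_span` (Deligne's split square of an abelian FOURFOLD: the locus SPSQ(4,d) of the split eightfold components,
  rung R2₈) and `weilClassesOf_twistedSquare_four_eq_span`.

Use (B2b ladder `hodge-weil`, `LADDER.md ## CARVER v6` C43 "CLASS test first"; door A∘S(4,d) of C39/C42 wants ONE seed `q·h⁴ + w` on ONE
hyperbolic eightfold): a candidate cycle class `[Z]` at a sixfold / eightfold square is of the required shape `q·h₀ⁿ + w`, `w ∈ W_K`, iff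
`[Z] - q·h₀ⁿ ∈ ℚX ⊕ ℚY` — an identity between explicit polynomials in divisor classes. Honest label: bookkeeping (Deligne LNM 900 Rem. 4.10 made
explicit in degrees 3 and 4); no named fact; not a rung; the definitions are abbreviations of explicit formulas.

## References

* [Deligne1982HodgeCycles] P. Deligne, LNM 900 (1982), §4 Lemma 4.5 and Remark 4.10.
* [vanGeemen1994HodgeAV] B. van Geemen, LNM 1594 (1994), 4.9, 5.2 (rational structure of the Weil plane).
* [Hatcher2002] A. Hatcher, Algebraic Topology (2002), §3.2.
-/

noncomputable section

open CategoryTheory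

namespace Literature.AlgebraicGeometry.HodgeTheory

open Literature.AlgebraicTopology.SingularHomology
open Literature.AlgebraicGeometry.Motives

section HodgeTheory

/-! ### The cube of `R + μS`, nested as `cupPowTwo` -/

/-- The **triple cup product `((1 ⌣ a) ⌣ b) ⌣ c ∈ H⁶`** of degree-two classes, nested and degree-cast exactly as `cupPowTwo x 3`
(so that `cupPowTwo x 3 = cupThree x x x` definitionally). [cite: Hatcher2002, §3.2] -/
def cupThree {Y : Type} [TopologicalSpace Y] (a b c : singularCohomology ℂ ℂ Y 2) : singularCohomology ℂ ℂ Y (2 * 3) :=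
  cupProduct (two_mul_add_two 2)
    (cupProduct (two_mul_add_two 1) (cupProduct (two_mul_add_two 0) (singularCohomology.one ℂ Y) a) b) c

variable {Y : Type} [TopologicalSpace Y]

/-- `x³ = ((1 ⌣ x) ⌣ x) ⌣ x`. [cite: Hatcher2002, §3.2] -/
theorem cupPowTwo_three (x : singularCohomology ℂ ℂ Y 2) : cupPowTwo x 3 = cupThree x x x := rfl

/-- **`(R + μS)³ = RRR + μ(RRS + RSR + SRR) + μ²(RSS + SRS + SSR) + μ³SSS`** (trilinearity only; no commutation of the factors).
[cite: Hatcher2002, §3.2] -/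
theorem cupPowTwo_add_smul_three (R S : singularCohomology ℂ ℂ Y 2) (μ : ℂ) :
    cupPowTwo (R + μ • S) 3 =
      cupThree R R R + μ • (cupThree R R S + cupThree R S R + cupThree S R R) +
        (μ * μ) • (cupThree R S S + cupThree S R S + cupThree S S R) + (μ * μ * μ) • cupThree S S S := by
  simp only [cupPowTwo_three, cupThree, map_add, map_smul, LinearMap.add_apply, LinearMap.smul_apply]
  module

/-- Naturality: `f^*(cupThree a b c) = cupThree (f^*a) (f^*b) (f^*c)`. [cite: Hatcher2002, §3.2 Prop. 3.10] -/
theorem map_cupThree {Y' : Type} [TopologicalSpace Y'] (f : C(Y', Y)) (a b c : singularCohomology ℂ ℂ Y 2) :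
    singularCohomology.map ℂ ℂ f (2 * 3) (cupThree a b c) =
      cupThree (singularCohomology.map ℂ ℂ f 2 a) (singularCohomology.map ℂ ℂ f 2 b) (singularCohomology.map ℂ ℂ f 2 c) := by
  have h1 : singularCohomology.map ℂ ℂ f (2 * 0) (singularCohomology.one ℂ Y) = singularCohomology.one ℂ Y' :=
    singularCohomology.map_one f
  simp only [cupThree, cupProduct_map, h1]

/-- `cupThree` of rational classes is rational. [cite: Hatcher2002, §3.2] -/
theorem IsRationalClass.cupThree {a b c : singularCohomology ℂ ℂ Y 2} (ha : IsRationalClass a) (hb : IsRationalClass b)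
    (hc : IsRationalClass c) : IsRationalClass (cupThree a b c) :=
  (((isRationalClass_one Y).cup _ ha).cup _ hb).cup _ hc

/-- `c - (d : ℂ) • c'` is rational for rational `c, c'` and `d : ℕ`. [folklore] -/
theorem IsRationalClass.sub_natCast_smul {k : ℕ} {c c' : singularCohomology ℂ ℂ Y k} (hc : IsRationalClass c)
    (hc' : IsRationalClass c') (d : ℕ) : IsRationalClass (c - (d : ℂ) • c') := by
  have h := hc.add (hc'.zsmul (-(d : ℤ)))
  rwa [neg_smul, ← sub_eq_add_neg, ← Int.cast_smul_eq_zsmul ℂ, Int.cast_natCast] at h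

/-- The **quadruple cup product `(((1 ⌣ a) ⌣ b) ⌣ c) ⌣ e ∈ H⁸`**, nested and degree-cast exactly as `cupPowTwo x 4`.
[cite: Hatcher2002, §3.2] -/
def cupFour {Y : Type} [TopologicalSpace Y] (a b c e : singularCohomology ℂ ℂ Y 2) : singularCohomology ℂ ℂ Y (2 * 4) :=
  cupProduct (two_mul_add_two 3) (cupThree a b c) e

/-- `x⁴ = (((1 ⌣ x) ⌣ x) ⌣ x) ⌣ x`. [cite: Hatcher2002, §3.2] -/
theorem cupPowTwo_four (x : singularCohomology ℂ ℂ Y 2) : cupPowTwo x 4 = cupFour x x x x := rfl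

/-- **`(R + μS)⁴` expanded by quadrilinearity** (no commutation of the factors): the terms are grouped by the number of `S`-factors, with
coefficients `1, μ, μ², μ³, μ⁴`. [cite: Hatcher2002, §3.2] -/
theorem cupPowTwo_add_smul_four (R S : singularCohomology ℂ ℂ Y 2) (μ : ℂ) :
    cupPowTwo (R + μ • S) 4 =
      cupFour R R R R + μ • (cupFour R R R S + cupFour R R S R + cupFour R S R R + cupFour S R R R) +
        (μ * μ) • (cupFour R R S S + cupFour R S R S + cupFour R S S R + cupFour S R R S + cupFour S R S R + cupFour S S R R) +
        (μ * μ * μ) • (cupFour R S S S + cupFour S R S S + cupFour S S R S + cupFour S S S R) +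
        (μ * μ * μ * μ) • cupFour S S S S := by
  simp only [cupPowTwo_four, cupFour, cupThree, map_add, map_smul, LinearMap.add_apply, LinearMap.smul_apply]
  module

/-- `cupFour` of rational classes is rational. [cite: Hatcher2002, §3.2] -/
theorem IsRationalClass.cupFour {a b c e : singularCohomology ℂ ℂ Y 2} (ha : IsRationalClass a) (hb : IsRationalClass b)
    (hc : IsRationalClass c) (he : IsRationalClass e) : IsRationalClass (cupFour a b c e) :=
  (ha.cupThree hb hc).cup _ he

/-! ### `X` and `Y` -/

variable {A T : Motives.AbelianVariety ℂ}

/-- **`X(θ) = RRR - d·(RSS + SRS + SSR) ∈ H⁶(A(ℂ); ℂ)`**, `R = q₁^*θ - d·q₂^*θ`, `S = (q₁+q₂)^*θ - q₁^*θ - q₂^*θ`: the `μ`-free part of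
`Ω_μ(θ)^{⌣3}` (`= R³ - 3d·RS²` after commuting). [cite: Deligne1982HodgeCycles, §4 Remark 4.10] -/
def weilX (q₁ q₂ : A ⟶ T) (d : ℕ) (θ : complexBetti T.X 2) : complexBetti A.X (2 * 3) :=
  let R := complexBetti.map q₁.hom.hom.hom 2 θ - (d : ℂ) • complexBetti.map q₂.hom.hom.hom 2 θ
  let S := complexBetti.map (q₁ + q₂).hom.hom.hom 2 θ - complexBetti.map q₁.hom.hom.hom 2 θ - complexBetti.map q₂.hom.hom.hom 2 θ
  cupThree R R R - (d : ℂ) • (cupThree R S S + cupThree S R S + cupThree S S R)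

/-- **`Y(θ) = (RRS + RSR + SRR) - d·SSS ∈ H⁶(A(ℂ); ℂ)`**: the coefficient of `μ` in `Ω_μ(θ)^{⌣3}` (`= 3R²S - d·S³` after commuting).
[cite: Deligne1982HodgeCycles, §4 Remark 4.10] -/
def weilY (q₁ q₂ : A ⟶ T) (d : ℕ) (θ : complexBetti T.X 2) : complexBetti A.X (2 * 3) :=
  let R := complexBetti.map q₁.hom.hom.hom 2 θ - (d : ℂ) • complexBetti.map q₂.hom.hom.hom 2 θ
  let S := complexBetti.map (q₁ + q₂).hom.hom.hom 2 θ - complexBetti.map q₁.hom.hom.hom 2 θ - complexBetti.map q₂.hom.hom.hom 2 θ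
  (cupThree R R S + cupThree R S R + cupThree S R R) - (d : ℂ) • cupThree S S S

/-- **`Ω_μ(θ)^{⌣3} = X(θ) + μ·Y(θ)` for `μ² = -d`.** [cite: Deligne1982HodgeCycles, §4 Remark 4.10] -/
theorem cupPowTwo_weilGenerator_three (q₁ q₂ : A ⟶ T) (d : ℕ) {μ : ℂ} (hμ : μ * μ = -(d : ℂ))
    (θ : complexBetti T.X 2) :
    cupPowTwo (weilGenerator q₁ q₂ d μ θ) 3 = weilX q₁ q₂ d θ + μ • weilY q₁ q₂ d θ := by
  have hμ3 : μ * μ * μ = -(d : ℂ) * μ := by rw [hμ]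
  rw [weilGenerator, cupPowTwo_add_smul_three, hμ3, hμ, weilX, weilY]
  module

/-- `X(θ)` is a rational class when `θ` is. [cite: vanGeemen1994HodgeAV, 4.9] -/
theorem isRationalClass_weilX (q₁ q₂ : A ⟶ T) (d : ℕ) {θ : complexBetti T.X 2} (hθ : IsRationalClass θ) :
    IsRationalClass (weilX q₁ q₂ d θ) := by
  have h1 : IsRationalClass (complexBetti.map q₁.hom.hom.hom 2 θ) := hθ.pullback _
  have h2 : IsRationalClass (complexBetti.map q₂.hom.hom.hom 2 θ) := hθ.pullback _
  have h12 : IsRationalClass (complexBetti.map (q₁ + q₂).hom.hom.hom 2 θ) := hθ.pullback _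
  have hR : IsRationalClass (complexBetti.map q₁.hom.hom.hom 2 θ - (d : ℂ) • complexBetti.map q₂.hom.hom.hom 2 θ) :=
    h1.sub_natCast_smul h2 d
  have hS : IsRationalClass (complexBetti.map (q₁ + q₂).hom.hom.hom 2 θ - complexBetti.map q₁.hom.hom.hom 2 θ -
      complexBetti.map q₂.hom.hom.hom 2 θ) := by
    have h := (h12.sub_natCast_smul h1 1).sub_natCast_smul h2 1
    simpa only [Nat.cast_one, one_smul] using h
  exact (hR.cupThree hR hR).sub_natCast_smul (((hR.cupThree hS hS).add (hS.cupThree hR hS)).add (hS.cupThree hS hR)) d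

/-- `Y(θ)` is a rational class when `θ` is. [cite: vanGeemen1994HodgeAV, 4.9] -/
theorem isRationalClass_weilY (q₁ q₂ : A ⟶ T) (d : ℕ) {θ : complexBetti T.X 2} (hθ : IsRationalClass θ) :
    IsRationalClass (weilY q₁ q₂ d θ) := by
  have h1 : IsRationalClass (complexBetti.map q₁.hom.hom.hom 2 θ) := hθ.pullback _
  have h2 : IsRationalClass (complexBetti.map q₂.hom.hom.hom 2 θ) := hθ.pullback _
  have h12 : IsRationalClass (complexBetti.map (q₁ + q₂).hom.hom.hom 2 θ) := hθ.pullback _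
  have hR : IsRationalClass (complexBetti.map q₁.hom.hom.hom 2 θ - (d : ℂ) • complexBetti.map q₂.hom.hom.hom 2 θ) :=
    h1.sub_natCast_smul h2 d
  have hS : IsRationalClass (complexBetti.map (q₁ + q₂).hom.hom.hom 2 θ - complexBetti.map q₁.hom.hom.hom 2 θ -
      complexBetti.map q₂.hom.hom.hom 2 θ) := by
    have h := (h12.sub_natCast_smul h1 1).sub_natCast_smul h2 1
    simpa only [Nat.cast_one, one_smul] using h
  exact (((hR.cupThree hR hS).add (hR.cupThree hS hR)).add (hS.cupThree hR hR)).sub_natCast_smul (hS.cupThree hS hS) d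

/-- **`X₄(θ) = RRRR - d·Σ_{|S|=2} + d²·SSSS ∈ H⁸(A(ℂ); ℂ)`**: the `μ`-free part of `Ω_μ(θ)^{⌣4}` (`= R⁴ - 6dR²S² + d²S⁴` after commuting).
[cite: Deligne1982HodgeCycles, §4 Remark 4.10] -/
def weilX₄ (q₁ q₂ : A ⟶ T) (d : ℕ) (θ : complexBetti T.X 2) : complexBetti A.X (2 * 4) :=
  let R := complexBetti.map q₁.hom.hom.hom 2 θ - (d : ℂ) • complexBetti.map q₂.hom.hom.hom 2 θ
  let S := complexBetti.map (q₁ + q₂).hom.hom.hom 2 θ - complexBetti.map q₁.hom.hom.hom 2 θ - complexBetti.map q₂.hom.hom.hom 2 θ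
  cupFour R R R R - (d : ℂ) • (cupFour R R S S + cupFour R S R S + cupFour R S S R + cupFour S R R S + cupFour S R S R +
    cupFour S S R R) + ((d : ℂ) * d) • cupFour S S S S

/-- **`Y₄(θ) = Σ_{|S|=1} - d·Σ_{|S|=3} ∈ H⁸(A(ℂ); ℂ)`**: the coefficient of `μ` in `Ω_μ(θ)^{⌣4}` (`= 4R³S - 4dRS³` after commuting).
[cite: Deligne1982HodgeCycles, §4 Remark 4.10] -/
def weilY₄ (q₁ q₂ : A ⟶ T) (d : ℕ) (θ : complexBetti T.X 2) : complexBetti A.X (2 * 4) :=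
  let R := complexBetti.map q₁.hom.hom.hom 2 θ - (d : ℂ) • complexBetti.map q₂.hom.hom.hom 2 θ
  let S := complexBetti.map (q₁ + q₂).hom.hom.hom 2 θ - complexBetti.map q₁.hom.hom.hom 2 θ - complexBetti.map q₂.hom.hom.hom 2 θ
  (cupFour R R R S + cupFour R R S R + cupFour R S R R + cupFour S R R R) -
    (d : ℂ) • (cupFour R S S S + cupFour S R S S + cupFour S S R S + cupFour S S S R)

/-- **`Ω_μ(θ)^{⌣4} = X₄(θ) + μ·Y₄(θ)` for `μ² = -d`.** [cite: Deligne1982HodgeCycles, §4 Remark 4.10] -/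
theorem cupPowTwo_weilGenerator_four (q₁ q₂ : A ⟶ T) (d : ℕ) {μ : ℂ} (hμ : μ * μ = -(d : ℂ))
    (θ : complexBetti T.X 2) :
    cupPowTwo (weilGenerator q₁ q₂ d μ θ) 4 = weilX₄ q₁ q₂ d θ + μ • weilY₄ q₁ q₂ d θ := by
  have hμ3 : μ * μ * μ = -(d : ℂ) * μ := by rw [hμ]
  have hμ4 : μ * μ * μ * μ = (d : ℂ) * d := by rw [hμ, mul_assoc, hμ, neg_mul_neg]
  rw [weilGenerator, cupPowTwo_add_smul_four, hμ4, hμ3, hμ, weilX₄, weilY₄]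
  module

/-- `X₄(θ)` is a rational class when `θ` is. [cite: vanGeemen1994HodgeAV, 4.9] -/
theorem isRationalClass_weilX₄ (q₁ q₂ : A ⟶ T) (d : ℕ) {θ : complexBetti T.X 2} (hθ : IsRationalClass θ) :
    IsRationalClass (weilX₄ q₁ q₂ d θ) := by
  have h1 : IsRationalClass (complexBetti.map q₁.hom.hom.hom 2 θ) := hθ.pullback _
  have h2 : IsRationalClass (complexBetti.map q₂.hom.hom.hom 2 θ) := hθ.pullback _
  have h12 : IsRationalClass (complexBetti.map (q₁ + q₂).hom.hom.hom 2 θ) := hθ.pullback _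
  have hR : IsRationalClass (complexBetti.map q₁.hom.hom.hom 2 θ - (d : ℂ) • complexBetti.map q₂.hom.hom.hom 2 θ) :=
    h1.sub_natCast_smul h2 d
  have hS : IsRationalClass (complexBetti.map (q₁ + q₂).hom.hom.hom 2 θ - complexBetti.map q₁.hom.hom.hom 2 θ -
      complexBetti.map q₂.hom.hom.hom 2 θ) := by
    have h := (h12.sub_natCast_smul h1 1).sub_natCast_smul h2 1
    simpa only [Nat.cast_one, one_smul] using h
  have hdd : IsRationalClass (((d : ℂ) * d) • cupFour
      (complexBetti.map (q₁ + q₂).hom.hom.hom 2 θ - complexBetti.map q₁.hom.hom.hom 2 θ - complexBetti.map q₂.hom.hom.hom 2 θ)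
      (complexBetti.map (q₁ + q₂).hom.hom.hom 2 θ - complexBetti.map q₁.hom.hom.hom 2 θ - complexBetti.map q₂.hom.hom.hom 2 θ)
      (complexBetti.map (q₁ + q₂).hom.hom.hom 2 θ - complexBetti.map q₁.hom.hom.hom 2 θ - complexBetti.map q₂.hom.hom.hom 2 θ)
      (complexBetti.map (q₁ + q₂).hom.hom.hom 2 θ - complexBetti.map q₁.hom.hom.hom 2 θ - complexBetti.map q₂.hom.hom.hom 2 θ)) := by
    have h := (hS.cupFour hS hS hS).smul ((d : ℚ) * d)
    simpa only [Rat.cast_mul, Rat.cast_natCast] using h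
  exact ((hR.cupFour hR hR hR).sub_natCast_smul ((((((hR.cupFour hR hS hS).add (hR.cupFour hS hR hS)).add
    (hR.cupFour hS hS hR)).add (hS.cupFour hR hR hS)).add (hS.cupFour hR hS hR)).add (hS.cupFour hS hR hR)) d).add hdd

/-- `Y₄(θ)` is a rational class when `θ` is. [cite: vanGeemen1994HodgeAV, 4.9] -/
theorem isRationalClass_weilY₄ (q₁ q₂ : A ⟶ T) (d : ℕ) {θ : complexBetti T.X 2} (hθ : IsRationalClass θ) :
    IsRationalClass (weilY₄ q₁ q₂ d θ) := by
  have h1 : IsRationalClass (complexBetti.map q₁.hom.hom.hom 2 θ) := hθ.pullback _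
  have h2 : IsRationalClass (complexBetti.map q₂.hom.hom.hom 2 θ) := hθ.pullback _
  have h12 : IsRationalClass (complexBetti.map (q₁ + q₂).hom.hom.hom 2 θ) := hθ.pullback _
  have hR : IsRationalClass (complexBetti.map q₁.hom.hom.hom 2 θ - (d : ℂ) • complexBetti.map q₂.hom.hom.hom 2 θ) :=
    h1.sub_natCast_smul h2 d
  have hS : IsRationalClass (complexBetti.map (q₁ + q₂).hom.hom.hom 2 θ - complexBetti.map q₁.hom.hom.hom 2 θ -
      complexBetti.map q₂.hom.hom.hom 2 θ) := by
    have h := (h12.sub_natCast_smul h1 1).sub_natCast_smul h2 1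
    simpa only [Nat.cast_one, one_smul] using h
  exact ((((hR.cupFour hR hR hS).add (hR.cupFour hR hS hR)).add (hR.cupFour hS hR hR)).add (hS.cupFour hR hR hR)).sub_natCast_smul
    ((((hR.cupFour hS hS hS).add (hS.cupFour hR hS hS)).add (hS.cupFour hS hR hS)).add (hS.cupFour hS hS hR)) d

/-! ### The plane `W_K ⊗ ℂ = span {X, Y}` -/

/-- `span {X + μY, X - μY} = span {X, Y}` for `μ ≠ 0` (invertible change of basis). [folklore] -/
theorem span_pair_add_smul_sub_smul {V : Type*} [AddCommGroup V] [Module ℂ V] (X Y : V) {μ : ℂ} (hμ : μ ≠ 0) :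
    Submodule.span ℂ {X + μ • Y, X + (-μ) • Y} = Submodule.span ℂ {X, Y} := by
  have h2 : (2 : ℂ) ≠ 0 := two_ne_zero
  have h2μ : (2 * μ) ≠ 0 := mul_ne_zero two_ne_zero hμ
  refine le_antisymm (Submodule.span_le.2 ?_) (Submodule.span_le.2 ?_)
  · intro v hv
    simp only [Set.mem_insert_iff, Set.mem_singleton_iff] at hv
    rcases hv with hv | hv <;> rw [hv]
    · exact Submodule.mem_span_pair.2 ⟨1, μ, by rw [one_smul]⟩
    · exact Submodule.mem_span_pair.2 ⟨1, -μ, by rw [one_smul]⟩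
  · intro v hv
    simp only [Set.mem_insert_iff, Set.mem_singleton_iff] at hv
    have hP : X + μ • Y ∈ Submodule.span ℂ {X + μ • Y, X + (-μ) • Y} := Submodule.subset_span (by simp)
    have hM : X + (-μ) • Y ∈ Submodule.span ℂ {X + μ • Y, X + (-μ) • Y} := Submodule.subset_span (by simp)
    rcases hv with hv | hv <;> rw [hv]
    · have key : (X + μ • Y) + (X + (-μ) • Y) = (2 : ℂ) • X := by module
      have h := Submodule.smul_mem _ (2 : ℂ)⁻¹ (Submodule.add_mem _ hP hM)
      rwa [key, inv_smul_smul₀ h2] at h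
    · have key : (X + μ • Y) - (X + (-μ) • Y) = (2 * μ) • Y := by module
      have h := Submodule.smul_mem _ (2 * μ)⁻¹ (Submodule.sub_mem _ hP hM)
      rwa [key, inv_smul_smul₀ h2μ] at h

variable {d : ℕ} {Φ : A ⟶ A} {q₁ q₂ : A ⟶ T}

/-- **Sixfold squares: `W_K ⊗ ℂ = span_ℂ {X(θ), Y(θ)}`** — under the hypotheses of the abstract square theorem with `g = 3` (`dim T = 3`,
`dim A = 6`, `Φ ≫ Φ = -d`, `Φ ≫ q₂ = q₁`, `Φ ≫ q₁ = -d·q₂`, `q₁^* + c·q₂^*` injective for `c² = -d`) and `θ^{⌣3} ≠ 0`, the Weil plane is spanned by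
the two explicit cubic divisor polynomials `X`, `Y` (rational when `θ` is: `isRationalClass_weilX/Y`). [cite: Deligne1982HodgeCycles, §4 Remark 4.10]
[cite: vanGeemen1994HodgeAV, 4.9] -/
theorem weilClassesOf_eq_span_weilX_weilY (hT : T.dim = 3) (hA : A.dim = 2 * 3) (hd : 0 < d) (hΦ : Φ ≫ Φ = -(d • 𝟙 A))
    (h₂ : Φ ≫ q₂ = q₁) (h₁ : Φ ≫ q₁ = -(d • q₂))
    (hinj : ∀ (c : ℂ) (v : complexBetti T.X 1), c * c = -(d : ℂ) →
      complexBetti.map q₁.hom.hom.hom 1 v + c • complexBetti.map q₂.hom.hom.hom 1 v = 0 → v = 0)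
    {θ : complexBetti T.X 2} (hθ : cupPowTwo θ 3 ≠ 0) :
    weilClassesOf A Φ 3 d = Submodule.span ℂ {weilX q₁ q₂ d θ, weilY q₁ q₂ d θ} := by
  have hμ : (Complex.I * (Real.sqrt d : ℂ)) * (Complex.I * (Real.sqrt d : ℂ)) = -(d : ℂ) := by
    rw [← pow_two, I_mul_sqrt_sq]
  have hμ' : (-(Complex.I * (Real.sqrt d : ℂ))) * (-(Complex.I * (Real.sqrt d : ℂ))) = -(d : ℂ) := by
    rw [neg_mul_neg, hμ]
  rw [weilClassesOf_eq_span_cupPowTwo_weilGenerator (by norm_num) hT hA hd hΦ h₂ h₁ hinj hθ,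
    cupPowTwo_weilGenerator_three q₁ q₂ d hμ, cupPowTwo_weilGenerator_three q₁ q₂ d hμ',
    span_pair_add_smul_sub_smul _ _ (I_mul_sqrt_ne_zero hd)]

/-- **Split sixfold square `(T × T, Φ_d)`, `T` an abelian THREEFOLD: `W_K ⊗ ℂ = span {X, Y}`** with `(q₁, q₂) = (p₁, p₂)`
(`R = θ₁ - dθ₂`, `S = ω = (p₁+p₂)^*θ - θ₁ - θ₂`), for every `θ ∈ H²(T(ℂ); ℂ)` with `θ³ ≠ 0`; `X, Y` rational when `θ` is.
[cite: Deligne1982HodgeCycles, §4 Lemma 4.5 and Remark 4.10] -/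
theorem weilClassesOf_splitSquare_three_eq_span (hT : T.dim = 3) (hd : 0 < d) {θ : complexBetti T.X 2}
    (hθ : cupPowTwo θ 3 ≠ 0) :
    weilClassesOf (T.prod T)
        (AbelianVariety.prodLift (AbelianVariety.snd T T ≫ (-(d • 𝟙 T))) (AbelianVariety.fst T T)) 3 d =
      Submodule.span ℂ {weilX (AbelianVariety.fst T T) (AbelianVariety.snd T T) d θ,
        weilY (AbelianVariety.fst T T) (AbelianVariety.snd T T) d θ} :=
  weilClassesOf_eq_span_weilX_weilY hT (dim_twistedSquare hT) hd splitSquare_comp_self splitSquare_comp_snd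
    (by rw [splitSquare_comp_fst, Preadditive.comp_neg, Preadditive.comp_nsmul, Category.comp_id])
    (fun c v _ hv => splitSquare_virtual_injective c v hv) hθ

/-- **Twisted sixfold square `(T × T, φ × (-φ))`, `φ ≫ φ = -d`, `T` an abelian THREEFOLD: `W_K ⊗ ℂ = span {X, Y}`** with
`(q₁, q₂) = (p₁ ≫ φ - p₂ ≫ φ, p₁ + p₂)`, for every `θ` with `θ³ ≠ 0`; `X, Y` rational when `θ` is. In particular at the CM square
`E³(ι) × E³(ῑ)` (`T = E³`) and at the twisted squares of Picard-type threefolds in EVERY sixfold component `(K, 3, δ)`.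
[cite: Schoen1998HodgeWeilAddendum, §10] [cite: Deligne1982HodgeCycles, §4 Remark 4.10] -/
theorem weilClassesOf_twistedSquare_three_eq_span (hT : T.dim = 3) (hd : 0 < d) {φ : T ⟶ T} (hφ : φ ≫ φ = -(d • 𝟙 T))
    {θ : complexBetti T.X 2} (hθ : cupPowTwo θ 3 ≠ 0) :
    weilClassesOf (T.prod T)
        (AbelianVariety.prodLift (AbelianVariety.fst T T ≫ φ) (AbelianVariety.snd T T ≫ (-φ))) 3 d =
      Submodule.span ℂ {weilX (AbelianVariety.fst T T ≫ φ - AbelianVariety.snd T T ≫ φ)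
          (AbelianVariety.fst T T + AbelianVariety.snd T T) d θ,
        weilY (AbelianVariety.fst T T ≫ φ - AbelianVariety.snd T T ≫ φ) (AbelianVariety.fst T T + AbelianVariety.snd T T) d θ} := by
  refine weilClassesOf_eq_span_weilX_weilY hT (dim_twistedSquare hT) hd (twistedSquare_comp_self hφ) twistedSquare_comp_add
    (twistedSquare_comp_sub hφ) (fun c v hc hv => ?_) hθ
  have hc0 : c ≠ 0 := by
    rintro rfl
    rw [zero_mul, eq_comm, neg_eq_zero, Nat.cast_eq_zero] at hc
    omega
  exact twistedSquare_virtual_injective hc0 v hv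

/-- **Eightfold squares: `W_K ⊗ ℂ = span_ℂ {X₄(θ), Y₄(θ)}`** — the abstract square theorem with `g = 4` (`dim T = 4`, `dim A = 8`) and
`θ^{⌣4} ≠ 0`; `X₄`, `Y₄` rational when `θ` is. These `(A, Φ)` include the anchors SPSQ(4,d) / TWSQ(4,d) of the ladder's door A(4,·).
[cite: Deligne1982HodgeCycles, §4 Remark 4.10] [cite: vanGeemen1994HodgeAV, 4.9] -/
theorem weilClassesOf_eq_span_weilX₄_weilY₄ (hT : T.dim = 4) (hA : A.dim = 2 * 4) (hd : 0 < d) (hΦ : Φ ≫ Φ = -(d • 𝟙 A))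
    (h₂ : Φ ≫ q₂ = q₁) (h₁ : Φ ≫ q₁ = -(d • q₂))
    (hinj : ∀ (c : ℂ) (v : complexBetti T.X 1), c * c = -(d : ℂ) →
      complexBetti.map q₁.hom.hom.hom 1 v + c • complexBetti.map q₂.hom.hom.hom 1 v = 0 → v = 0)
    {θ : complexBetti T.X 2} (hθ : cupPowTwo θ 4 ≠ 0) :
    weilClassesOf A Φ 4 d = Submodule.span ℂ {weilX₄ q₁ q₂ d θ, weilY₄ q₁ q₂ d θ} := by
  have hμ : (Complex.I * (Real.sqrt d : ℂ)) * (Complex.I * (Real.sqrt d : ℂ)) = -(d : ℂ) := by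
    rw [← pow_two, I_mul_sqrt_sq]
  have hμ' : (-(Complex.I * (Real.sqrt d : ℂ))) * (-(Complex.I * (Real.sqrt d : ℂ))) = -(d : ℂ) := by
    rw [neg_mul_neg, hμ]
  rw [weilClassesOf_eq_span_cupPowTwo_weilGenerator (by norm_num) hT hA hd hΦ h₂ h₁ hinj hθ,
    cupPowTwo_weilGenerator_four q₁ q₂ d hμ, cupPowTwo_weilGenerator_four q₁ q₂ d hμ',
    span_pair_add_smul_sub_smul _ _ (I_mul_sqrt_ne_zero hd)]

/-- **Split eightfold square `(T × T, Φ_d)`, `T` an abelian FOURFOLD: `W_K ⊗ ℂ = span {X₄, Y₄}`** (`(q₁, q₂) = (p₁, p₂)`; `R = θ₁ - dθ₂`,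
`S = ω`), for every `θ` with `θ⁴ ≠ 0` — the `10`-dimensional locus SPSQ(4,d) of the split eightfold components (rung R2₈ of the ladder).
[cite: Deligne1982HodgeCycles, §4 Lemma 4.5 and Remark 4.10] -/
theorem weilClassesOf_splitSquare_four_eq_span (hT : T.dim = 4) (hd : 0 < d) {θ : complexBetti T.X 2}
    (hθ : cupPowTwo θ 4 ≠ 0) :
    weilClassesOf (T.prod T)
        (AbelianVariety.prodLift (AbelianVariety.snd T T ≫ (-(d • 𝟙 T))) (AbelianVariety.fst T T)) 4 d =
      Submodule.span ℂ {weilX₄ (AbelianVariety.fst T T) (AbelianVariety.snd T T) d θ,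
        weilY₄ (AbelianVariety.fst T T) (AbelianVariety.snd T T) d θ} :=
  weilClassesOf_eq_span_weilX₄_weilY₄ hT (dim_twistedSquare hT) hd splitSquare_comp_self splitSquare_comp_snd
    (by rw [splitSquare_comp_fst, Preadditive.comp_neg, Preadditive.comp_nsmul, Category.comp_id])
    (fun c v _ hv => splitSquare_virtual_injective c v hv) hθ

/-- **Twisted eightfold square `(T × T, φ × (-φ))`, `φ ≫ φ = -d`, `T` an abelian FOURFOLD: `W_K ⊗ ℂ = span {X₄, Y₄}`**
(`(q₁, q₂) = (p₁ ≫ φ - p₂ ≫ φ, p₁ + p₂)`), for every `θ` with `θ⁴ ≠ 0`; e.g. `X × X̄` for a Weil-type fourfold `X`, or the CM square `E⁴(ι) × E⁴(ῑ)`.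
[cite: Schoen1998HodgeWeilAddendum, §10] [cite: Deligne1982HodgeCycles, §4 Remark 4.10] -/
theorem weilClassesOf_twistedSquare_four_eq_span (hT : T.dim = 4) (hd : 0 < d) {φ : T ⟶ T} (hφ : φ ≫ φ = -(d • 𝟙 T))
    {θ : complexBetti T.X 2} (hθ : cupPowTwo θ 4 ≠ 0) :
    weilClassesOf (T.prod T)
        (AbelianVariety.prodLift (AbelianVariety.fst T T ≫ φ) (AbelianVariety.snd T T ≫ (-φ))) 4 d =
      Submodule.span ℂ {weilX₄ (AbelianVariety.fst T T ≫ φ - AbelianVariety.snd T T ≫ φ)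
          (AbelianVariety.fst T T + AbelianVariety.snd T T) d θ,
        weilY₄ (AbelianVariety.fst T T ≫ φ - AbelianVariety.snd T T ≫ φ) (AbelianVariety.fst T T + AbelianVariety.snd T T) d θ} := by
  refine weilClassesOf_eq_span_weilX₄_weilY₄ hT (dim_twistedSquare hT) hd (twistedSquare_comp_self hφ) twistedSquare_comp_add
    (twistedSquare_comp_sub hφ) (fun c v hc hv => ?_) hθ
  have hc0 : c ≠ 0 := by
    rintro rfl
    rw [zero_mul, eq_comm, neg_eq_zero, Nat.cast_eq_zero] at hc
    omega
  exact twistedSquare_virtual_injective hc0 v hv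

end HodgeTheory

end Literature.AlgebraicGeometry.HodgeTheory

end
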